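/-
Copyright (c) 2026 the pub-hodgecm-mathlib formalisation cell (harness21).  Prover seat hodgecm-mathlib-K2E3-p28 (g3) (E3 hand lent to strike line L1 by CHAIR K2-lead (g2)
VALVE WORD W4; LEAD F0P6-plan (g14) BATCH #174 (1) «U1 LEVEL 2 `htail` PRODUCER AT THE CARRIERS»; desk K2E3-p14 (g9) 23:53:40Z (deal suggestion, bytes)), Track B «K2-LIT» ∕
hLiu418 = stmt-HodgeConjecture-24832: organ U1-CT-ind stage 3 («U1-glob») LEVEL 2 — the `htail` letter of ★ LEVEL 1 p863127 ∕ ★ p863286 at the record carriers: the normalised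
singular Whittaker term `c • W_S(f_s)(h)` = (local value at `v₀`) × (`c · HEAD_{T∖v₀} · ζ-quotient · ∏_{v∈D} P_v`) on the convergence half-plane.  THEOREMS ONLY.
-/
import Summits.HodgeConjecture.HodgeConjecture.Theorems.K2LiuSingularWhittakerPlaceFactorEuler      -- ★ B2b FILE 2 (this seat): `whittakerDelta_eq_localFactor_mul_of_pureAt` (+ ★ G1)
import Summits.HodgeConjecture.HodgeConjecture.Theorems.K2LiuRankOneSingularEulerContinued          -- ★ (K1a-4) (R90-C14-p02): `tprod_eq_scalarK1_mul_finsetProd_cm` (tail collapse)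
import Summits.HodgeConjecture.HodgeConjecture.Theorems.K2LiuSiegelEisensteinKindWGlobalIntegrable  -- ★ (x-c): `integrable_conj_unipDeltaChar_mul` (`hG`)
import HarnessLib

/-!
# Crux `HLiu418`, U1-glob LEVEL 2 — `K2LiuLocalKernelTailOfRecord`: THE `htail` LETTER AT THE RECORD CARRIERS
# `c • W_S(f_s)(h) = Fn(s) · (c · HEAD_{T∖v₀}(s,h) · [ζ^T_{L⁺}(2s) ∕ (ζ^T_{L⁺}(2s+1)·L^T(2s+2, ε))] · ∏_{v∈D} P_v(s))` on `{n∕2 < re s}`   [KudlaRallis1994 §2; Tan1999 §3, §4 Prop. 4.8]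

Cell `hodgecm-mathlib`, crux item hLiu418 = `stmt-HodgeConjecture-24832`; squad K2, strike line L1, LEAD F0P6-plan (g14); desk K2E3-p14 (g9) (LEVEL 2 pen); box K2Liu-audit1;
prover K2E3-p28 (g3).  Lane `--supports stmt-HodgeConjecture-24832 --as helper` (count-neutral).  THEOREMS ONLY (no `def`, no `instance`, no notation, no named-fact hypothesis,
no `sorry`).  General frame `e : Fin N × Fin M ≃ Fin n` and index `S` (LEVEL 2 instantiates the corner index `S♭` of ★ (K1a-1)).

THE POINT (K2E3-p14 (g9)'s LEVEL-2 slot table §B, row `htail`).  ★ LEVEL 1 `K2LiuLocalKernelResidueVanishesOfPlaceLetters.resGen_eq_zero_of_kind_letters_placeLetters` takes per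
rank-one `(X, j, h)` the letter `htail : ∀ s, s₁ < re s → W X j h s = (κ X j s · N₃ X j s (hv X j h)) · Rst X j h s` with `W X () h s := c • whittakerDelta νN₀ X (f s) h`
(`c := (∫⁻ β₀ ∂νN₀).toReal⁻¹`, K1-a♮'s `hEac` subject), and ★ `K2LiuKindOneSingularGlobalAssembler.exists_Gc_of_placeLetters_scalarK1_cm_pure` (LH4-p07) then wants `Rst` in the shape
`Rst s h = c · HT s h · sc^{T″}(s) · ∏_{v∈D} P v s`.  THIS FILE produces exactly that identity from letters, composing three ★ bricks:
(1) ★ B2b FILE 2 `whittakerDelta_eq_localFactor_mul_of_pureAt` — `W_S(f_s)(h) = LOC_{v₀}(s) · (HEAD_{T∖v₀}(s,h) · ∏'_{v∉T} I_v(s))` for a head family pure at `v₀ ∈ T` (its letters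
`νN νv hνK νinf hmap hχ hfac bT rT hpure hh hw hS` BY VALUE — payers ★ (o1) `K2LiuStdSectionPlaceLettersOfRecord.exists_placeLetters_of_isStandard` at `T ⊇ T₀ ∪ {v₀}`, ★ Φ3b ∕
★ (KW-car) carriers, ★ B2b FILE 3 `K2LiuStdExtensionPureAt` — and `hG` DISCHARGED here by ★ (x-c) `integrable_conj_unipDeltaChar_mul` from `χ` unitary + Siegel sections + continuity);
(2) the LOCAL READING at `v₀` as ONE by-value letter with an ABSTRACT value `Fn` — `hloc : LOC_{v₀}(s) = Fn s` on `{n∕2 < re}` (payer: K2Liu-p13's TailGlue ∘ ★ p862989 (iii), `Fn := κ·N₃(·, hv)`);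
(3) the TAIL COLLAPSE ★ (K1a-4) `tprod_eq_scalarK1_mul_finsetProd_cm` — `∏'_{v∉T} I_v(s) = sc^{↑T}(s) · ∏_{v∈D} P_v(s)` from the per-good-place VALUE letter `hI : I_v(s) = c^{K1}_v(s) · P_v(s)`
(payer: (K1a-2)∕(K1a-2d) ★ p862811 lineage, `P_v = 1` off the finite `D`, `D ∩ T = ∅`).
* §1 **`smul_whittakerDelta_eq_loc_mul_rest_of_letters`** — ⊢ `∀ s, n∕2 < re s → c • W_S(f_s)(h) = Fn s · (c · HT s h · sc^{↑T}(s) · ∏_{v∈D} P v s)` with `HT s h :=` ★ FILE 2's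
  `T∖v₀`-head VERBATIM — LEVEL 1's `htail` (`s₁ := n∕2`) AND ★ p863286's `htail` input (`T″ := ↑T`, `c := (c : ℂ)`) at once, `Rst` EXPLICIT.
References: [KudlaRallis1994] §2 (2.10)–(2.12); [Tan1999] §3, §4 Prop. 4.8; [MoeglinWaldspurger1995] II.1.7; [CasselsFrohlichANT1967] Ch. XV (Tate) Thm. 3.3.1.
HONEST LABEL.  Count-neutral helper: `HC_CM` is proved only modulo the 7 printed citations (2 remaining named inputs: hLiu418 = `stmt-HodgeConjecture-24832`,
h413 = `stmt-HodgeConjecture-24833`) until rung 0 closes; LEVEL 2 stays OPEN (TailGlue, `hN₃`, the (K1a-3) local faces, composition by K2E3-p14).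
-/

set_option autoImplicit false
set_option linter.dupNamespace false -- the mandated namespace repeats `HodgeConjecture.HodgeConjecture`

noncomputable section

open scoped Matrix RestrictedProduct ENNReal NNReal Topology ComplexConjugate
open NumberField IsDedekindDomain MeasureTheory Measure Filter Set

namespace Summit.HodgeConjecture.HodgeConjecture.Cruxes.HLiu418.K2LiuLocalKernelTailOfRecord

open Literature.NumberTheory.Automorphic Literature.NumberTheory.LFunctions Literature.NumberTheory.GaloisRepresentations
open Literature.NumberTheory.GelbartRogawski1991 Literature.NumberTheory.GelbartRogawski1991.GRConstruction
open Literature.NumberTheory.K2Lit.SiegelDoubled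
open Literature.NumberTheory.K2Lit.PlaceSplitting
open Literature.MeasureTheory.RestrictedProduct
open Literature.Topology.Algebra.RestrictedProduct (inH)
open Summit.HodgeConjecture.HodgeConjecture.Cruxes.HLiu418.K2LiuSiegelUnipotentLocalDefs
open Summit.HodgeConjecture.HodgeConjecture.Cruxes.HLiu418.K2LiuSiegelUnipotentSplitDefs
open Summit.HodgeConjecture.HodgeConjecture.Cruxes.HLiu418.K2LiuSiegelUnipotentSplitAtDefs
open Summit.HodgeConjecture.HodgeConjecture.Cruxes.HLiu418.K2LiuSiegelUnipotentFourierDefs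
open Summit.HodgeConjecture.HodgeConjecture.Cruxes.HLiu418.K2LiuSingularWhittakerPlaceFactorEuler (whittakerDelta_eq_localFactor_mul_of_pureAt)
open Summit.HodgeConjecture.HodgeConjecture.Cruxes.HLiu418.K2LiuRankOneSingularEulerContinued (tprod_eq_scalarK1_mul_finsetProd_cm)
open Summit.HodgeConjecture.HodgeConjecture.Cruxes.HLiu418.K2LiuSiegelEisensteinKindWGlobalIntegrable (integrable_conj_unipDeltaChar_mul)

variable (L : Type) [Field L] [NumberField L] [IsCMField L]
variable {N M n : ℕ} (e : Fin N × Fin M ≃ Fin n)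
  (dV : Fin N → L) (hdV : ∀ i, IsCMField.complexConj L (dV i) = dV i)
  (dW : Fin M → L) (hdW : ∀ i, IsCMField.complexConj L (dW i) = dW i)
  (T : Finset (HeightOneSpectrum (𝓞 (Fp L)))) [DecidableEq (HeightOneSpectrum (𝓞 (Fp L)))]
  [MeasurableSpace ↥(unipDelta L e dV hdV dW hdW)] [BorelSpace ↥(unipDelta L e dV hdV dW hdW)]
  [MeasurableSpace ↥(unipDeltaArch L e dV hdV dW hdW)] [BorelSpace ↥(unipDeltaArch L e dV hdV dW hdW)]
  [∀ v : HeightOneSpectrum (𝓞 (Fp L)), MeasurableSpace ↥(unipDeltaLoc L e dV hdV dW hdW v)] [∀ v : HeightOneSpectrum (𝓞 (Fp L)), BorelSpace ↥(unipDeltaLoc L e dV hdV dW hdW v)]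

/-! ## §1 The `htail` letter at the record carriers -/

set_option maxHeartbeats 1200000 in -- MEASURED: `whnf` of the STATEMENT fails at 800 000, passes at 1 200 000 (★ B2b FILE 2's binder telescope — itself ★ G1's 800 000 class — plus the `hloc`∕`hI` letters and the collapsed tail); proof is `have`∕`rw`∕`ring` only
/-- **THE `htail` LETTER AT THE RECORD CARRIERS.**  ★ B2b FILE 2's letters verbatim (`hG` discharged from `χ` unitary, Siegel sections, continuity), a scalar `c : ℝ` (LEVEL 2:
`(∫⁻ β₀ ∂νN₀).toReal⁻¹`), the local reading at `v₀` as a letter `hloc : LOC_{v₀}(s) = Fn s` (abstract `Fn`; LEVEL 2: `κ s · N₃ s hv`), and the per-good-place tail value letter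
`hI : I_v(s) = c^{K1}_v(s) · P_v(s)` off `T` with `P_v = 1` off a finite `D` disjoint from `T`.  THEN for `n∕2 < re s`:
`c • W_S(f_s)(h) = Fn s · ((c : ℂ) · HT s h · [ζ^{T}(2s) ∕ (ζ^{T}(2s+1)·L^{T}(2s+2, ε_{L∕L⁺}))] · ∏_{v∈D} P_v(s))`, `HT` = ★ FILE 2's head over `ν_∞ ⊗ ⨂_{w∈T, w≠v₀} ν_w` —
★ LEVEL 1's `htail` (`s₁ := n∕2`) with `Rst` EXPLICIT in ★ p863286's input shape (`T″ := ↑T`). [cite: KudlaRallis1994, §2] [cite: Tan1999, §3; §4 Prop. 4.8]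
[cite: MoeglinWaldspurger1995, II.1.7] [cite: CasselsFrohlichANT1967, Ch. XV (Tate) Thm. 3.3.1] -/
theorem smul_whittakerDelta_eq_loc_mul_rest_of_letters (hdV0 : ∀ i, dV i ≠ 0) (hdW0 : ∀ i, dW i ≠ 0) (hn : 1 ≤ n)
    (νN : Measure ↥(unipDelta L e dV hdV dW hdW)) [νN.IsHaarMeasure]
    (νv : ∀ v : HeightOneSpectrum (𝓞 (Fp L)), Measure ↥(unipDeltaLoc L e dV hdV dW hdW v)) [∀ v, (νv v).IsHaarMeasure] [∀ v, SigmaFinite (νv v)]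
    (hνK : ∀ v, v ∉ T → νv v (((inH (fun v => UnitaryGroup.localInt L (IsCMField.complexConj L) (n + n) (hermD L e dV hdV dW hdW) v) (fun v => unipDeltaLoc L e dV hdV dW hdW v) v) : Subgroup ↥(unipDeltaLoc L e dV hdV dW hdW v)) : Set ↥(unipDeltaLoc L e dV hdV dW hdW v)) = 1)
    (νinf : Measure ↥(unipDeltaArch L e dV hdV dW hdW)) [SigmaFinite νinf]
    (hmap : Measure.map (unipDeltaSplitAt L e dV hdV dW hdW T) νN =
      νinf.prod ((Measure.pi fun v : T => νv v.1).prod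
        (rpMeasure (fun v : {v : HeightOneSpectrum (𝓞 (Fp L)) // v ∉ T} => ((inH (fun v => UnitaryGroup.localInt L (IsCMField.complexConj L) (n + n) (hermD L e dV hdV dW hdW) v) (fun v => unipDeltaLoc L e dV hdV dW hdW v) v.1 : Subgroup ↥(unipDeltaLoc L e dV hdV dW hdW v.1)) : Set ↥(unipDeltaLoc L e dV hdV dW hdW v.1))) (fun v => νv v.1) ∅)))
    {χ : HeckeCharacter L} (hχu : χ.IsUnitary) (hχ : ∀ v, v ∉ T → ∀ w' : UnitaryGroup.PlacesOver L v, χ.IsUnramifiedAt w'.1)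
    {f : ℂ → HA L e dV hdV dW hdW → ℂ} (hsec : ∀ s, IsSiegelDeltaSection L e dV hdV dW hdW χ s (f s)) (hfc : ∀ s, Continuous (f s))
    {fT : ℂ → UnitaryGroup.arch (Fp L) L (IsCMField.complexConj L) (n + n) (hermD L e dV hdV dW hdW) ×
      (Π v : T, UnitaryGroup.localPi L (IsCMField.complexConj L) (n + n) (hermD L e dV hdV dW hdW) v.1) → ℂ}
    (hfac : IsFactorizableOff L e dV hdV dW hdW T χ f fT)
    (v₀ : T) (bT : ℂ → UnitaryGroup.localPi L (IsCMField.complexConj L) (n + n) (hermD L e dV hdV dW hdW) v₀.1 → ℂ)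
    (rT : ℂ → UnitaryGroup.arch (Fp L) L (IsCMField.complexConj L) (n + n) (hermD L e dV hdV dW hdW) ×
      (Π w : {w : T // w ≠ v₀}, UnitaryGroup.localPi L (IsCMField.complexConj L) (n + n) (hermD L e dV hdV dW hdW) w.1.1) → ℂ)
    (hpure : ∀ (s : ℂ) (a : UnitaryGroup.arch (Fp L) L (IsCMField.complexConj L) (n + n) (hermD L e dV hdV dW hdW))
      (q : Π v : T, UnitaryGroup.localPi L (IsCMField.complexConj L) (n + n) (hermD L e dV hdV dW hdW) v.1),
      fT s (a, q) = bT s (q v₀) * rT s (a, fun w : {w : T // w ≠ v₀} => q w.1))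
    (S : Matrix (Fin n) (Fin n) L) {h : HA L e dV hdV dW hdW}
    (hh : ∀ v, v ∉ T → UnitaryGroup.evalPlace (Fp L) L (IsCMField.complexConj L) (n + n) (hermD L e dV hdV dW hdW) v
      (UnitaryGroup.finPart (Fp L) L (IsCMField.complexConj L) (n + n) (hermD L e dV hdV dW hdW) h) ∈
        UnitaryGroup.localInt L (IsCMField.complexConj L) (n + n) (hermD L e dV hdV dW hdW) v)
    (hw : ∀ v, v ∉ T → UnitaryGroup.evalPlace (Fp L) L (IsCMField.complexConj L) (n + n) (hermD L e dV hdV dW hdW) v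
      (UnitaryGroup.finPart (Fp L) L (IsCMField.complexConj L) (n + n) (hermD L e dV hdV dW hdW) (weylDelta L e dV hdV dW hdW)) ∈
        UnitaryGroup.localInt L (IsCMField.complexConj L) (n + n) (hermD L e dV hdV dW hdW) v)
    (hS : ∀ v, v ∉ T → ∀ (w : UnitaryGroup.PlacesOver L v) (i j : Fin n), ((S i j : L) : w.1.adicCompletion L) ∈ w.1.adicCompletionIntegers L)
    -- the normalising scalar, the local reading at `v₀` (abstract value), the per-good-place tail values
    (c : ℝ) (Fn : ℂ → ℂ)
    (hloc : ∀ s : ℂ, (n : ℝ) / 2 < s.re →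
      ∫ y, conj (unipDeltaChar L e dV hdV dW hdW S
            (locToAdelic L e dV hdV dW hdW v₀.1 (y : UnitaryGroup.localPi L (IsCMField.complexConj L) (n + n) (hermD L e dV hdV dW hdW) v₀.1)) : ℂ) *
          bT s (UnitaryGroup.evalPlace (Fp L) L (IsCMField.complexConj L) (n + n) (hermD L e dV hdV dW hdW) v₀.1
                (UnitaryGroup.finPart (Fp L) L (IsCMField.complexConj L) (n + n) (hermD L e dV hdV dW hdW) (weylDelta L e dV hdV dW hdW)) *
              (y : UnitaryGroup.localPi L (IsCMField.complexConj L) (n + n) (hermD L e dV hdV dW hdW) v₀.1) *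
              UnitaryGroup.evalPlace (Fp L) L (IsCMField.complexConj L) (n + n) (hermD L e dV hdV dW hdW) v₀.1
                (UnitaryGroup.finPart (Fp L) L (IsCMField.complexConj L) (n + n) (hermD L e dV hdV dW hdW) h)) ∂(νv v₀.1) = Fn s)
    (D : Finset (HeightOneSpectrum (𝓞 (Fp L)))) (hDT : ∀ v ∈ D, v ∉ T) (P : HeightOneSpectrum (𝓞 (Fp L)) → ℂ → ℂ)
    (hP1 : ∀ v, v ∉ T → v ∉ D → ∀ s : ℂ, P v s = 1)
    (hI : ∀ s : ℂ, (n : ℝ) / 2 < s.re → ∀ v : {v : HeightOneSpectrum (𝓞 (Fp L)) // v ∉ T},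
      ∫ y, conj (unipDeltaChar L e dV hdV dW hdW S
            (locToAdelic L e dV hdV dW hdW v.1 (y : UnitaryGroup.localPi L (IsCMField.complexConj L) (n + n) (hermD L e dV hdV dW hdW) v.1)) : ℂ) *
          LambdaLoc L e dV hdV dW hdW v.1 χ s
            (UnitaryGroup.evalPlace (Fp L) L (IsCMField.complexConj L) (n + n) (hermD L e dV hdV dW hdW) v.1
                (UnitaryGroup.finPart (Fp L) L (IsCMField.complexConj L) (n + n) (hermD L e dV hdV dW hdW) (weylDelta L e dV hdV dW hdW)) *
              (y : UnitaryGroup.localPi L (IsCMField.complexConj L) (n + n) (hermD L e dV hdV dW hdW) v.1)) ∂(νv v.1) =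
        ((1 - (v.1.residueCard : ℂ) ^ (-(2 * s + 1))) *
            (1 - (quadraticHeckeCharCM L).valueAtUniformizer v.1 * (v.1.residueCard : ℂ) ^ (-(2 * s + 2)))) /
          (1 - (v.1.residueCard : ℂ) ^ (-(2 * s))) * P v.1 s) :
    ∀ s : ℂ, (n : ℝ) / 2 < s.re →
      c • whittakerDelta L e dV hdV dW hdW νN S (f s) h =
        Fn s *
          ((c : ℂ) *
            (∫ p, (conj (unipDeltaChar L e dV hdV dW hdW S
                    (UnitaryGroup.archToAdelic (Fp L) L (IsCMField.complexConj L) (n + n) (hermD L e dV hdV dW hdW)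
                      (p.1 : UnitaryGroup.arch (Fp L) L (IsCMField.complexConj L) (n + n) (hermD L e dV hdV dW hdW))) : ℂ) *
                  ∏ w : {w : T // w ≠ v₀}, conj (unipDeltaChar L e dV hdV dW hdW S
                    (locToAdelic L e dV hdV dW hdW w.1.1
                      ((p.2 w : ↥(unipDeltaLoc L e dV hdV dW hdW w.1.1)) : UnitaryGroup.localPi L (IsCMField.complexConj L) (n + n) (hermD L e dV hdV dW hdW) w.1.1)) : ℂ)) *
                rT s (UnitaryGroup.archPart (Fp L) L (IsCMField.complexConj L) (n + n) (hermD L e dV hdV dW hdW) (weylDelta L e dV hdV dW hdW) *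
                      (p.1 : UnitaryGroup.arch (Fp L) L (IsCMField.complexConj L) (n + n) (hermD L e dV hdV dW hdW)) *
                      UnitaryGroup.archPart (Fp L) L (IsCMField.complexConj L) (n + n) (hermD L e dV hdV dW hdW) h,
                    fun w : {w : T // w ≠ v₀} => UnitaryGroup.evalPlace (Fp L) L (IsCMField.complexConj L) (n + n) (hermD L e dV hdV dW hdW) w.1.1
                        (UnitaryGroup.finPart (Fp L) L (IsCMField.complexConj L) (n + n) (hermD L e dV hdV dW hdW) (weylDelta L e dV hdV dW hdW)) *
                      ((p.2 w : ↥(unipDeltaLoc L e dV hdV dW hdW w.1.1)) : UnitaryGroup.localPi L (IsCMField.complexConj L) (n + n) (hermD L e dV hdV dW hdW) w.1.1) *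
                      UnitaryGroup.evalPlace (Fp L) L (IsCMField.complexConj L) (n + n) (hermD L e dV hdV dW hdW) w.1.1
                        (UnitaryGroup.finPart (Fp L) L (IsCMField.complexConj L) (n + n) (hermD L e dV hdV dW hdW) h))
                ∂(νinf.prod (Measure.pi fun w : {w : T // w ≠ v₀} => νv w.1.1))) *
            (partialStandardL (↑T : Set (HeightOneSpectrum (𝓞 (Fp L)))) (fun _ => {1}) (2 * s) /
              (partialStandardL (↑T : Set (HeightOneSpectrum (𝓞 (Fp L)))) (fun _ => {1}) (2 * s + 1) *
                partialStandardL (↑T : Set (HeightOneSpectrum (𝓞 (Fp L)))) (fun v => {(quadraticHeckeCharCM L).valueAtUniformizer v}) (2 * s + 2))) *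
            ∏ v ∈ D, P v s) := by
  intro s hs
  have hn' : (1 : ℝ) ≤ (n : ℝ) := by exact_mod_cast hn
  have hs' : 1 / 2 < s.re := by linarith
  -- ★ (x-c): the twisted integrand is `L¹(νN)`; ★ B2b FILE 2: isolate the place `v₀`
  have hG := integrable_conj_unipDeltaChar_mul L e dV hdV dW hdW hdV0 hdW0 hχu hs (hsec s) (hfc s) νN S h
  have hF2 := whittakerDelta_eq_localFactor_mul_of_pureAt L e dV hdV dW hdW T νN νv hνK νinf hmap hχ hfac v₀ bT rT hpure s S hh hw hS hG
  -- ★ (K1a-4): collapse the restricted-product tail to the partial `ζ`∕`L` quotient times the finite product over `D`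
  have hDT' : ∀ v ∈ D, v ∉ (↑T : Set (HeightOneSpectrum (𝓞 (Fp L)))) := fun v hv hvT => hDT v hv (Finset.mem_coe.1 hvT)
  have hP1' : ∀ v, v ∉ (↑T : Set (HeightOneSpectrum (𝓞 (Fp L)))) → v ∉ D → P v s = 1 :=
    fun v hvT hvD => hP1 v (fun h' => hvT (Finset.mem_coe.2 h')) hvD s
  have hcol : (∏' v : {v : HeightOneSpectrum (𝓞 (Fp L)) // v ∉ T},
      ∫ y, conj (unipDeltaChar L e dV hdV dW hdW S
            (locToAdelic L e dV hdV dW hdW v.1 (y : UnitaryGroup.localPi L (IsCMField.complexConj L) (n + n) (hermD L e dV hdV dW hdW) v.1)) : ℂ) *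
          LambdaLoc L e dV hdV dW hdW v.1 χ s
            (UnitaryGroup.evalPlace (Fp L) L (IsCMField.complexConj L) (n + n) (hermD L e dV hdV dW hdW) v.1
                (UnitaryGroup.finPart (Fp L) L (IsCMField.complexConj L) (n + n) (hermD L e dV hdV dW hdW) (weylDelta L e dV hdV dW hdW)) *
              (y : UnitaryGroup.localPi L (IsCMField.complexConj L) (n + n) (hermD L e dV hdV dW hdW) v.1)) ∂(νv v.1)) =
      partialStandardL (↑T : Set (HeightOneSpectrum (𝓞 (Fp L)))) (fun _ => {1}) (2 * s) /
          (partialStandardL (↑T : Set (HeightOneSpectrum (𝓞 (Fp L)))) (fun _ => {1}) (2 * s + 1) *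
            partialStandardL (↑T : Set (HeightOneSpectrum (𝓞 (Fp L)))) (fun v => {(quadraticHeckeCharCM L).valueAtUniformizer v}) (2 * s + 2)) *
        ∏ v ∈ D, P v s := by
    exact tprod_eq_scalarK1_mul_finsetProd_cm L (↑T : Set (HeightOneSpectrum (𝓞 (Fp L)))) hs' D hDT' (fun v => P v s) hP1' _
      (fun v => hI s hs ⟨v.1, fun h' => v.2 (Finset.mem_coe.2 h')⟩)
  rw [Complex.real_smul, hF2, hloc s hs, hcol]
  ring

end Summit.HodgeConjecture.HodgeConjecture.Cruxes.HLiu418.K2LiuLocalKernelTailOfRecord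

end
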